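import Summits.FinalStateConjecture.FinalStateConjecture.Theorems.SwallowTheDatumKerrShieldedDataExistCapRadius
import Summits.FinalStateConjecture.FinalStateConjecture.Theorems.KerrShieldedDataExist.Negative.BentSlopeBounds
import Summits.FinalStateConjecture.FinalStateConjecture.Theorems.KerrShieldedDataExist.Negative.BentHeightSmooth
import Mathlib.Analysis.SpecialFunctions.Log.Deriv
import HarnessLib

/-!
# `KerrShieldedDataExist`, line `plug-the-second-sheet` (skeleton v4 "KerrCap") — stub `stub_capProfile`:
# the profile functions of the Kerr cap

Support file (`--supports stmt-FinalStateConjecture-10055`) for the thesis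
`Summit.FinalStateConjecture.FinalStateConjecture.Theses.SwallowTheDatum.KerrShieldedDataExist`: the registered
stub `stub_capProfile` of the line skeleton `Cruxes/KerrShieldedDataExist/Lines/plug_the_second_sheet.lean`
(v4, "KerrCap"), proved verbatim. It is pure one-variable real analysis: the profiles `(τ, ϱ, α)` of the radial
variable `s = ‖u‖` of the cap map `Ψ(u) = (τ(s), L_{ϱ(s)} Rot_z(α(s)) (u/s))` and a smooth inverse `ϱinv` of the
radius on the graph zone, glued with smooth steps `S = Real.smoothTransition` (blend lemmas of `…CapRadius`):

* `KerrCap.exists_capRadius` — the RADIUS `ϱ = r₀ + S((s − σ₃)/(σ₄ − σ₃)) (ϱ₂ − r₀)`: the constant cylinder radius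
  `r₀ < r₊` blended across the corner `[σ₃, σ₄]`, `σ₄ = σ₃ + (r_b − r₀)`, `r_b = (r₀ + r₊)/2`, into the
  graph-zone radius `ϱ₂` of `KerrCap.exists_graphRadius` (strictly increasing bijection of `ℝ`, `ϱ₂(σ₄) = r_b`,
  `ϱ₂(σ₃) = (r₀ + r_b)/2 > r₀`, smooth inverse `ϱinv`, quasi-isotropic Boyer–Lindquist radius
  `s + M + (M² − a²)/4s` of Kerr(`M, a`) far out — Brandt–Seidel 1996): `ϱ ≥ r₀`, `ϱ′ ≥ 0`, `ϱ ≤ r_b` up to `σ₄`,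
  `ϱ′ > 0` from `σ₄` on, `ϱinv ∘ ϱ = id` beyond `σ₄`;
* `KerrCap.exists_capCore` — the HEIGHT `τ = (s + τ₀) + S((s − σ₃)/(σ₄ − σ₃)) (T_{M,a}(ϱ) + c − s − τ₀)`,
  `c = σ₄ + τ₀ + 1`, `T_{M,a} = Negative.bentHeight M a` the crux's literal bent height (`T ≡ 0` below `4M > r₊`,
  `T′ = bentSlope ≥ 0`): `τ′ ≥ 1 − S ≥ 0` and `τ′ + ϱ′ > 0`;
* `stub_capProfile` — adds the ANGLE `α = −arctan(a/r₀) + S(s − σ₅ + 1)(χ(ϱ) + arctan(a/r₀))`,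
  `χ(r) = (a/(r₊ − r₋)) log((r − r₊)/(r − r₋))` (the Boyer–Lindquist → ingoing-Kerr untwisting, `χ′ = a/Δ`),
  `σ₅ = σ₄ + 10M + 3`, smooth because `ϱ = s + M + (M² − a²)/4s > r₊` on `s ≥ σ₄ + 2M + 2`, and `ϱ > 8M` beyond `σ₅`.

Everything is proved; no definitions, no named facts.

References: S. R. Brandt, E. Seidel, Phys. Rev. D 54 (1996) 1403, §II (quasi-isotropic radius);
M. Dafermos, I. Rodnianski, arXiv:0811.0354, §5.1 (Kerr-star height and azimuth); Li–Mei, arXiv:2005.01249, §2.2.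
-/

-- the doubled `FinalStateConjecture` path component is the summit/problem naming scheme, not a mistake
set_option linter.dupNamespace false

noncomputable section

open Set Filter Topology
open scoped ContDiff Topology
open Literature.Geometry.Lorentzian

namespace Summit.FinalStateConjecture.FinalStateConjecture.Theorems.SwallowTheDatum

namespace KerrCap

open Summit.FinalStateConjecture.FinalStateConjecture.Theorems.KerrShieldedDataExist

/-! ### The radius profile `ϱ` of the cap: cylinder `r₀`, corner, graph-zone radius -/

section Core

variable {M a r₀ σ₃ : ℝ}

/-- **The radius profile of the cap.** For sub-extremal `|a| < M`, `r₀ < r₊` and `σ₃ ≥ 1` there are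
`σ₄ > σ₃`, a junction radius `r_b = (r₀ + r₊)/2 ∈ (r₀, r₊)`, a `C^∞` profile `ϱ` and a `C^∞` function `ϱinv` with:
`ϱ ≡ r₀` on `s ≤ σ₃`; `ϱ ≥ r₀`, `ϱ′ ≥ 0` everywhere; `ϱ ≤ r_b` on `s ≤ σ₄`; `ϱ′ > 0` on `s ≥ σ₄`; `ϱ > r_b` on
`s > σ₄` with `ϱinv ∘ ϱ = id` there and `ϱ ∘ ϱinv = id`, `ϱinv > σ₄` on `(r_b, ∞)`; and `ϱ(s) = s + M + (M² − a²)/4s`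
(quasi-isotropic Boyer–Lindquist radius) for `s ≥ σ₄ + 2M + 2`. It is the blend `r₀ + S((s − σ₃)/(σ₄ − σ₃))(ϱ₂ − r₀)`
of the constant `r₀` into the graph-zone radius `ϱ₂` of `exists_graphRadius` (`ϱ₂(σ₃) = (r₀ + r_b)/2 > r₀`).
[cite: BrandtSeidel1996, §II] -/
theorem exists_capRadius (ha : |a| < M) (hr₀p : r₀ < Kerr.rPlus M a) (hσ₃ : 1 ≤ σ₃) :
    ∃ (ϱ ϱinv : ℝ → ℝ) (σ₄ rb : ℝ),
      σ₃ < σ₄ ∧ r₀ < rb ∧ rb < Kerr.rPlus M a ∧ ContDiff ℝ ∞ ϱ ∧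
      (∀ s, s ≤ σ₃ → ϱ s = r₀) ∧ (∀ s, r₀ ≤ ϱ s) ∧ (∀ s, 0 ≤ deriv ϱ s) ∧
      (∀ s, s ≤ σ₄ → ϱ s ≤ rb) ∧ (∀ s, σ₄ ≤ s → 0 < deriv ϱ s) ∧
      (∀ s, σ₄ < s → rb < ϱ s ∧ ϱinv (ϱ s) = s) ∧
      (∀ r, rb < r → σ₄ < ϱinv r ∧ ϱ (ϱinv r) = r) ∧
      ContDiff ℝ ∞ ϱinv ∧
      (∀ s, σ₄ + 2 * M + 2 ≤ s → ϱ s = s + M + (M ^ 2 - a ^ 2) / (4 * s)) := by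
  have hM : 0 < M := Negative.mass_pos ha
  have hrp2 : Kerr.rPlus M a ≤ 2 * M := Negative.rPlus_le_two_mul ha
  have ha2 : a ^ 2 ≤ M ^ 2 := by nlinarith [Negative.sq_sub_sq_pos ha]
  set rb : ℝ := (r₀ + Kerr.rPlus M a) / 2 with hrb
  have hrb0 : r₀ < rb := by rw [hrb]; linarith
  have hrbp : rb < Kerr.rPlus M a := by rw [hrb]; linarith
  set σ₄ : ℝ := σ₃ + (rb - r₀) with hσ₄
  have hd : 0 < σ₄ - σ₃ := by rw [hσ₄]; linarith
  have hσ₄0 : 0 < σ₄ := by linarith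
  obtain ⟨ϱ₂, ϱinv, hϱ₂s, hϱinvs, hmono, hϱ₂d, hinv1, hinv2, hlin, hfar⟩ :=
    exists_graphRadius hM ha2 (hrbp.trans_le hrp2) hσ₄0
  have hϱ₂σ₄ : ϱ₂ σ₄ = rb := by rw [hlin σ₄ (by linarith)]; ring
  have hϱ₂σ₃ : r₀ < ϱ₂ σ₃ := by
    rw [hlin σ₃ (by linarith)]
    have : σ₃ - σ₄ = -(rb - r₀) := by rw [hσ₄]; ring
    rw [this]; linarith
  have hϱ₂r₀ : ∀ s, σ₃ ≤ s → r₀ < ϱ₂ s := fun s hs ↦ hϱ₂σ₃.trans_le (hmono.monotone hs)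
  set ϱ : ℝ → ℝ := fun s ↦ r₀ + Real.smoothTransition ((s - σ₃) / (σ₄ - σ₃)) * (ϱ₂ s - r₀) with hϱ
  -- zone values
  have hcyl : ∀ s, s ≤ σ₃ → ϱ s = r₀ := fun s hs ↦
    blend_of_le (f := fun _ : ℝ ↦ r₀) (g := ϱ₂) hd hs
  have hgraph : ∀ s, σ₄ ≤ s → ϱ s = ϱ₂ s := fun s hs ↦
    blend_of_ge (f := fun _ : ℝ ↦ r₀) (g := ϱ₂) hd (by linarith)
  -- smoothness and the derivative
  have hϱs : ContDiff ℝ ∞ ϱ :=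
    contDiff_iff_contDiffAt.2 fun s ↦ contDiffAt_blend contDiffAt_const hϱ₂s.contDiffAt
  have hϱd : ∀ s, HasDerivAt ϱ (deriv Real.smoothTransition ((s - σ₃) / (σ₄ - σ₃)) / (σ₄ - σ₃) * (ϱ₂ s - r₀) +
      Real.smoothTransition ((s - σ₃) / (σ₄ - σ₃)) * deriv ϱ₂ s) s := fun s ↦ by
    have h := hasDerivAt_blend (p := σ₃) (d := σ₄ - σ₃) (g := ϱ₂) (hasDerivAt_const s r₀) (hϱ₂d s).1
    refine h.congr_deriv ?_
    ring
  have hderiv : ∀ s, deriv ϱ s = deriv Real.smoothTransition ((s - σ₃) / (σ₄ - σ₃)) / (σ₄ - σ₃) * (ϱ₂ s - r₀) +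
      Real.smoothTransition ((s - σ₃) / (σ₄ - σ₃)) * deriv ϱ₂ s := fun s ↦ (hϱd s).deriv
  have hD0 : ∀ s, 0 ≤ deriv ϱ s := fun s ↦ by
    rw [hderiv]
    have h2 : 0 ≤ Real.smoothTransition ((s - σ₃) / (σ₄ - σ₃)) * deriv ϱ₂ s :=
      mul_nonneg (Real.smoothTransition.nonneg _) (hϱ₂d s).2.le
    rcases le_or_gt σ₃ s with hs | hs
    · exact add_nonneg (mul_nonneg (deriv_step_nonneg hd s) (sub_nonneg.2 (hϱ₂r₀ s hs).le)) h2
    · rw [deriv_step_eq_zero_of_le hd hs.le, zero_div, zero_mul, zero_add]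
      exact h2
  have hDpos : ∀ s, σ₄ ≤ s → 0 < deriv ϱ s := fun s hs ↦ by
    rw [hderiv, step_eq_one hd (by linarith), one_mul]
    exact add_pos_of_nonneg_of_pos
      (mul_nonneg (deriv_step_nonneg hd s) (sub_nonneg.2 (hϱ₂r₀ s (by linarith)).le)) (hϱ₂d s).2
  refine ⟨ϱ, ϱinv, σ₄, rb, by linarith, hrb0, hrbp, hϱs, hcyl, fun s ↦ ?_, hD0, fun s hs ↦ ?_, hDpos,
    fun s hs ↦ ?_, fun r hr ↦ ?_, hϱinvs, fun s hs ↦ ?_⟩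
  · -- `r₀ ≤ ϱ`
    rcases le_or_gt s σ₃ with hs | hs
    · rw [hcyl s hs]
    · show r₀ ≤ r₀ + Real.smoothTransition ((s - σ₃) / (σ₄ - σ₃)) * (ϱ₂ s - r₀)
      exact le_add_of_nonneg_right
        (mul_nonneg (Real.smoothTransition.nonneg _) (sub_nonneg.2 (hϱ₂r₀ s hs.le).le))
  · -- `ϱ ≤ r_b` up to `σ₄`
    rcases le_or_gt s σ₃ with hs' | hs'
    · rw [hcyl s hs']; exact hrb0.le
    · show r₀ + Real.smoothTransition ((s - σ₃) / (σ₄ - σ₃)) * (ϱ₂ s - r₀) ≤ rb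
      have h1 := Real.smoothTransition.le_one ((s - σ₃) / (σ₄ - σ₃))
      have h2 := (hϱ₂r₀ s hs'.le).le
      have h3 : ϱ₂ s ≤ rb := hϱ₂σ₄ ▸ hmono.monotone hs
      nlinarith
  · -- beyond `σ₄`: `ϱ = ϱ₂ > r_b`, left inverse
    rw [hgraph s hs.le]
    exact ⟨hϱ₂σ₄ ▸ hmono hs, hinv1 s⟩
  · -- on `(r_b, ∞)`: `ϱinv > σ₄`, right inverse
    have h1 : σ₄ < ϱinv r := hmono.lt_iff_lt.1 (by rw [hϱ₂σ₄, hinv2]; exact hr)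
    exact ⟨h1, by rw [hgraph _ h1.le, hinv2]⟩
  · -- far zone
    rw [hgraph s (by linarith)]
    exact hfar s hs

/-- **The radius and height profiles of the cap.** On top of `exists_capRadius`: the height
`τ = (s + τ₀) + S((s − σ₃)/(σ₄ − σ₃)) · (T_{M,a}(ϱ) + c − s − τ₀)` with `c = σ₄ + τ₀ + 1` is `C^∞`, equals
`s + τ₀` on the cylinder zone `s ≤ σ₃` and `T_{M,a}(ϱ(s)) + c` (the pinned bent leaf, `T = Negative.bentHeight M a`)
on the graph zone `s ≥ σ₄`, and has `τ′ ≥ 1 − S ≥ 0` (the bent slope is `≥ 0`; on `s ≤ σ₄` the radius stays below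
`r_b < r₊ < 4M` where `T ≡ 0`, so the corner term `S′ · (c − s − τ₀) ≥ 0`), whence `τ′ + ϱ′ > 0` everywhere.
[cite: arXiv08110354, §5.1] -/
theorem exists_capCore (ha : |a| < M) (hr₀p : r₀ < Kerr.rPlus M a) (hσ₃ : 1 ≤ σ₃) (τ₀ : ℝ) :
    ∃ (τ ϱ ϱinv : ℝ → ℝ) (σ₄ c rb : ℝ),
      σ₃ < σ₄ ∧ r₀ < rb ∧ rb < Kerr.rPlus M a ∧ ContDiff ℝ ∞ τ ∧ ContDiff ℝ ∞ ϱ ∧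
      (∀ s, s ≤ σ₃ → τ s = s + τ₀ ∧ ϱ s = r₀) ∧
      (∀ s, r₀ ≤ ϱ s) ∧ (∀ s, 0 ≤ deriv τ s) ∧ (∀ s, 0 ≤ deriv ϱ s) ∧
      (∀ s, 0 < deriv τ s + deriv ϱ s) ∧
      (∀ s, s ≤ σ₄ → ϱ s ≤ rb) ∧
      (∀ s, σ₄ ≤ s → τ s = Negative.bentHeight M a (ϱ s) + c ∧ 0 < deriv ϱ s) ∧
      (∀ s, σ₄ < s → rb < ϱ s ∧ ϱinv (ϱ s) = s) ∧
      (∀ r, rb < r → σ₄ < ϱinv r ∧ ϱ (ϱinv r) = r) ∧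
      ContDiffOn ℝ ∞ ϱinv (Set.Ioi rb) ∧
      (∀ s, σ₄ + 2 * M + 2 ≤ s → ϱ s = s + M + (M ^ 2 - a ^ 2) / (4 * s)) := by
  have hM : 0 < M := Negative.mass_pos ha
  obtain ⟨ϱ, ϱinv, σ₄, rb, h34, hrb0, hrbp, hϱs, hcyl, hge, hD0, hle, hDpos, hinv1, hinv2, hinvs, hfar⟩ :=
    exists_capRadius ha hr₀p hσ₃
  have hd : 0 < σ₄ - σ₃ := sub_pos.2 h34
  set c : ℝ := σ₄ + τ₀ + 1 with hc
  have hϱd : ∀ s, HasDerivAt ϱ (deriv ϱ s) s := fun s ↦ ((hϱs.differentiable (by simp)) s).hasDerivAt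
  have hT0 : ∀ s, s ≤ σ₄ → Negative.bentHeight M a (ϱ s) = 0 := fun s hs ↦
    Negative.bentHeight_eq_zero_of_le hM (by linarith [hle s hs, Negative.rPlus_lt_four_mul ha])
  set τ : ℝ → ℝ := fun s ↦ (s + τ₀) + Real.smoothTransition ((s - σ₃) / (σ₄ - σ₃)) *
      ((Negative.bentHeight M a (ϱ s) + c) - (s + τ₀)) with hτ
  have hτs : ContDiff ℝ ∞ τ := contDiff_iff_contDiffAt.2 fun s ↦
    contDiffAt_blend (contDiffAt_id.add contDiffAt_const)
      (((Negative.contDiff_bentHeight ha).contDiffAt.comp s hϱs.contDiffAt).add contDiffAt_const)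
  have hτd : ∀ s, HasDerivAt τ (1 + (deriv Real.smoothTransition ((s - σ₃) / (σ₄ - σ₃)) / (σ₄ - σ₃) *
      ((Negative.bentHeight M a (ϱ s) + c) - (s + τ₀)) +
      Real.smoothTransition ((s - σ₃) / (σ₄ - σ₃)) * (Negative.bentSlope M a (ϱ s) * deriv ϱ s - 1))) s :=
    fun s ↦ by
    have hf : HasDerivAt (fun s : ℝ ↦ s + τ₀) 1 s := (hasDerivAt_id' s).add_const τ₀
    have hg : HasDerivAt (fun s : ℝ ↦ Negative.bentHeight M a (ϱ s) + c)
        (Negative.bentSlope M a (ϱ s) * deriv ϱ s) s :=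
      ((Negative.hasDerivAt_bentHeight ha (ϱ s)).comp s (hϱd s)).add_const c
    exact hasDerivAt_blend hf hg
  have hτlow : ∀ s, 1 - Real.smoothTransition ((s - σ₃) / (σ₄ - σ₃)) ≤ deriv τ s := fun s ↦ by
    rw [(hτd s).deriv]
    have hS0 := Real.smoothTransition.nonneg ((s - σ₃) / (σ₄ - σ₃))
    have hB : 0 ≤ Real.smoothTransition ((s - σ₃) / (σ₄ - σ₃)) *
        (Negative.bentSlope M a (ϱ s) * deriv ϱ s) :=
      mul_nonneg hS0 (mul_nonneg (Negative.bentSlope_nonneg ha _) (hD0 s))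
    have hC : 0 ≤ deriv Real.smoothTransition ((s - σ₃) / (σ₄ - σ₃)) / (σ₄ - σ₃) *
        ((Negative.bentHeight M a (ϱ s) + c) - (s + τ₀)) := by
      rcases le_or_gt s σ₄ with hs | hs
      · refine mul_nonneg (deriv_step_nonneg hd s) ?_
        rw [hT0 s hs, hc]
        linarith
      · rw [deriv_step_eq_zero_of_ge hd (by linarith), zero_div, zero_mul]
    linarith
  have hτnonneg : ∀ s, 0 ≤ deriv τ s := fun s ↦
    (sub_nonneg.2 (Real.smoothTransition.le_one _)).trans (hτlow s)
  have hsum : ∀ s, 0 < deriv τ s + deriv ϱ s := fun s ↦ by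
    rcases le_or_gt σ₄ s with hs | hs
    · exact add_pos_of_nonneg_of_pos (hτnonneg s) (hDpos s hs)
    · have hS1 : Real.smoothTransition ((s - σ₃) / (σ₄ - σ₃)) < 1 :=
        Real.smoothTransition.lt_one_of_lt_one (by rw [div_lt_one hd]; linarith)
      linarith [hτlow s, hD0 s]
  have hτcyl : ∀ s, s ≤ σ₃ → τ s = s + τ₀ := fun s hs ↦
    blend_of_le (f := fun s : ℝ ↦ s + τ₀) (g := fun s : ℝ ↦ Negative.bentHeight M a (ϱ s) + c) hd hs
  have hτgraph : ∀ s, σ₄ ≤ s → τ s = Negative.bentHeight M a (ϱ s) + c := fun s hs ↦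
    blend_of_ge (f := fun s : ℝ ↦ s + τ₀) (g := fun s : ℝ ↦ Negative.bentHeight M a (ϱ s) + c) hd (by linarith)
  exact ⟨τ, ϱ, ϱinv, σ₄, c, rb, h34, hrb0, hrbp, hτs, hϱs, fun s hs ↦ ⟨hτcyl s hs, hcyl s hs⟩, hge, hτnonneg,
    hD0, hsum, hle, fun s hs ↦ ⟨hτgraph s hs, hDpos s hs⟩, hinv1, hinv2, hinvs.contDiffOn, hfar⟩

end Core

end KerrCap

open Summit.FinalStateConjecture.FinalStateConjecture.Theorems.KerrShieldedDataExist

/-- **Stub `stub_capProfile`** of line `plug-the-second-sheet` (crux `KerrShieldedDataExist`, skeleton v4 "KerrCap"):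
the profile functions `(τ, ϱ, α)` of the radial variable `s = ‖u‖` of the cap map and the smooth inverse `ϱinv` of the
radius on the graph zone. Cylinder zone `s ≤ σ₃` (`τ = s + τ₀`, `ϱ = r₀`, `α = −arctan(a/r₀)`); corner `[σ₃, σ₄]` in
the black-hole region (`τ′, ϱ′ ≥ 0`, `τ′ + ϱ′ > 0`, `ϱ ≤ r_b < r₊`); graph zone `s ≥ σ₄` (`τ = T_{M,a}(ϱ) + c`,
`ϱ′ > 0`, `ϱinv` smooth on `(r_b, ∞)`); far zone `s ≥ σ₅` (quasi-isotropic Boyer–Lindquist radius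
`ϱ = s + M + (M² − a²)/4s > 8M` and untwisting angle `α = (a/(r₊ − r₋)) log((ϱ − r₊)/(ϱ − r₋))`). The pair `(τ, ϱ)`
is `KerrCap.exists_capCore`; `α` is the blend `−arctan(a/r₀) + S(s − σ₅ + 1) · (χ(ϱ) + arctan(a/r₀))` across
`[σ₅ − 1, σ₅]`, `σ₅ = σ₄ + 10M + 3`, smooth because `ϱ > r₊` there. [cite: BrandtSeidel1996, §II] -/
theorem stub_capProfile :
    ∀ (M a r₀ τ₀ σ₃ : ℝ), |a| < M → Kerr.rMinus M a < r₀ → r₀ < Kerr.rPlus M a → 1 ≤ σ₃ →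
      ∃ (τ ϱ α ϱinv : ℝ → ℝ) (σ₄ σ₅ c rb : ℝ),
        σ₃ < σ₄ ∧ σ₄ < σ₅ ∧ r₀ < rb ∧ rb < Kerr.rPlus M a ∧
        ContDiff ℝ ∞ τ ∧ ContDiff ℝ ∞ ϱ ∧ ContDiff ℝ ∞ α ∧
        (∀ s, s ≤ σ₃ → τ s = s + τ₀ ∧ ϱ s = r₀ ∧ α s = -Real.arctan (a / r₀)) ∧
        (∀ s, r₀ ≤ ϱ s) ∧ (∀ s, 0 ≤ deriv τ s) ∧ (∀ s, 0 ≤ deriv ϱ s) ∧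
        (∀ s, 0 < deriv τ s + deriv ϱ s) ∧
        (∀ s, s ≤ σ₄ → ϱ s ≤ rb) ∧
        (∀ s, σ₄ ≤ s → τ s = Negative.bentHeight M a (ϱ s) + c ∧ 0 < deriv ϱ s) ∧
        (∀ s, σ₄ < s → rb < ϱ s ∧ ϱinv (ϱ s) = s) ∧
        (∀ r, rb < r → σ₄ < ϱinv r ∧ ϱ (ϱinv r) = r) ∧
        ContDiffOn ℝ ∞ ϱinv (Set.Ioi rb) ∧
        (∀ s, σ₅ ≤ s → ϱ s = s + M + (M ^ 2 - a ^ 2) / (4 * s) ∧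
          α s = a / (Kerr.rPlus M a - Kerr.rMinus M a) *
            Real.log ((ϱ s - Kerr.rPlus M a) / (ϱ s - Kerr.rMinus M a))) ∧
        (∀ s, σ₅ ≤ s → 8 * M < ϱ s) := by
  intro M a r₀ τ₀ σ₃ ha _ hr₀p hσ₃
  have hM : 0 < M := Negative.mass_pos ha
  have hMa : 0 < M ^ 2 - a ^ 2 := Negative.sq_sub_sq_pos ha
  have hrp2 : Kerr.rPlus M a ≤ 2 * M := Negative.rPlus_le_two_mul ha
  have hmp : Kerr.rMinus M a < Kerr.rPlus M a := Negative.rMinus_lt_rPlus ha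
  obtain ⟨τ, ϱ, ϱinv, σ₄, c, rb, h34, hrb0, hrbp, hτs, hϱs, hcyl, hge, hτ0, hϱ0, hsum, hle, hgraph, hinv1, hinv2,
    hinvs, hfar⟩ := KerrCap.exists_capCore ha hr₀p hσ₃ τ₀
  set σ₅ : ℝ := σ₄ + 10 * M + 3 with hσ₅
  -- the far zone lies beyond `r₊`
  have hfar' : ∀ s, σ₄ + 2 * M + 2 ≤ s → s + M < ϱ s := fun s hs ↦ by
    have hs0 : 0 < s := by linarith
    rw [hfar s hs]
    have h1 : 0 < (M ^ 2 - a ^ 2) / (4 * s) := div_pos hMa (by linarith)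
    linarith
  have hfarp : ∀ s, σ₄ + 2 * M + 2 ≤ s → Kerr.rPlus M a < ϱ s := fun s hs ↦ by
    have := hfar' s hs
    linarith
  set α : ℝ → ℝ := fun s ↦ -Real.arctan (a / r₀) + Real.smoothTransition ((s - (σ₅ - 1)) / 1) *
      (a / (Kerr.rPlus M a - Kerr.rMinus M a) * Real.log ((ϱ s - Kerr.rPlus M a) / (ϱ s - Kerr.rMinus M a)) -
        -Real.arctan (a / r₀)) with hα
  have hαs : ContDiff ℝ ∞ α := contDiff_iff_contDiffAt.2 fun s ↦ by
    rcases lt_or_ge s (σ₅ - 1) with hs | hs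
    · exact KerrCap.contDiffAt_blend_of_lt one_pos hs contDiffAt_const
    · have hs' : σ₄ + 2 * M + 2 ≤ s := by rw [hσ₅] at hs; linarith
      have h1 : 0 < ϱ s - Kerr.rPlus M a := sub_pos.2 (hfarp s hs')
      have h2 : 0 < ϱ s - Kerr.rMinus M a := by linarith
      have hϱa : ContDiffAt ℝ ∞ ϱ s := hϱs.contDiffAt
      refine KerrCap.contDiffAt_blend contDiffAt_const (contDiffAt_const.mul ?_)
      exact ((hϱa.sub contDiffAt_const).div (hϱa.sub contDiffAt_const) h2.ne').log (div_pos h1 h2).ne'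
  refine ⟨τ, ϱ, α, ϱinv, σ₄, σ₅, c, rb, h34, by rw [hσ₅]; linarith, hrb0, hrbp, hτs, hϱs, hαs,
    fun s hs ↦ ⟨(hcyl s hs).1, (hcyl s hs).2, ?_⟩, hge, hτ0, hϱ0, hsum, hle, hgraph, hinv1, hinv2, hinvs,
    fun s hs ↦ ⟨hfar s (by rw [hσ₅] at hs; linarith), ?_⟩, fun s hs ↦ ?_⟩
  · -- cylinder value of `α`
    exact KerrCap.blend_of_le (f := fun _ : ℝ ↦ -Real.arctan (a / r₀))
      (g := fun s : ℝ ↦ a / (Kerr.rPlus M a - Kerr.rMinus M a) *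
        Real.log ((ϱ s - Kerr.rPlus M a) / (ϱ s - Kerr.rMinus M a))) one_pos (by rw [hσ₅]; linarith)
  · -- far value of `α`
    exact KerrCap.blend_of_ge (f := fun _ : ℝ ↦ -Real.arctan (a / r₀))
      (g := fun s : ℝ ↦ a / (Kerr.rPlus M a - Kerr.rMinus M a) *
        Real.log ((ϱ s - Kerr.rPlus M a) / (ϱ s - Kerr.rMinus M a))) one_pos (by linarith)
  · -- `ϱ > 8M` on the far zone
    have := hfar' s (by rw [hσ₅] at hs; linarith)
    rw [hσ₅] at hs
    linarith

end Summit.FinalStateConjecture.FinalStateConjecture.Theorems.SwallowTheDatum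

end
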